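import Mathlib.Tactic.Ring
import Mathlib.Tactic.Linarith
import Mathlib.Tactic.Positivity
import Mathlib.Tactic.LinearCombination
import Mathlib.Data.Real.Basic
import Summits.HodgeConjecture.HodgeConjecture.Theorems.WeilClassTestProductFormula
import Summits.HodgeConjecture.HodgeConjecture.Theorems.WeilClassTestSignLaw
import HarnessLib

/-!
# Conjecture N in format (4,2) — part 2/4: wall signs and the two exclusion lemmas

Prover 2, generation 13. With `K := ∏_e (u_e − v₁)` (`= ∏_e (u_e − v₂)` on the pure locus), walls `w_e = u_e² − S_u/2` and
`β_e = (u_e − v₁)(u_e − v₂)`, the WALL IDENTITY (`WeilClassTestProductFormula.K0_add_wall_mulₑ`) gives `w_e·β_e = −K`. Consequences: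
* `no_config_K_neg_none_between`: `K < 0` and all `β_e > 0` (no E-charge between the F-charges) is impossible — all four E-walls are
  positive, hence both F-walls (`WeilClassTestSignLaw.F_walls_pos_of_E_walls_pos`, `σ ≠ 0`; `σ = 0` directly), and the gauge form of P2
  (`P2 = Σ heights·walls`, heights `≥ 0`) forces a zero height, contradicting `β₁ > 0` through ampleness;
* `no_config_K_pos_split`: `K > 0` with `u₁ < v₁ ≤ v₂ < u₄` (and `u₂, u₃ ∈ [u₁, u₄]`) is impossible — `w₁, w₄ < 0`, every other charge lies
  between `u₁` and `u₄` so its wall is negative by convexity, and P2 again forces a zero height.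
Pure algebra; nothing here is a case of HC, a rung or a door edge (C22). New cell result ⇒ Summits/.
-/

set_option linter.dupNamespace false

namespace Summit.HodgeConjecture.HodgeConjecture.WeilClassTestFormatFourTwo

open Summit.HodgeConjecture.HodgeConjecture.WeilClassTestProductFormula
/-- Wall sign from the wall identity, root `E₁`: on the pure locus `w·β = −K`; `β > 0 ∧ K < 0 ⇒ w > 0`. -/
theorem wall₁_pos_of_K_neg (u₁ u₂ u₃ u₄ v₁ v₂ : ℝ) (hC : u₁ + u₂ + u₃ + u₄ = v₁ + v₂)
    (hP4 : (u₁ ^ 3 + u₂ ^ 3 + u₃ ^ 3 + u₄ ^ 3) - (v₁ ^ 3 + v₂ ^ 3) = 0)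
    (hK : (u₁ - v₁) * (u₂ - v₁) * (u₃ - v₁) * (u₄ - v₁) < 0) (hβ : 0 < (u₁ - v₁) * (u₁ - v₂)) :
    0 < (u₁ ^ 2 - ((u₁ ^ 2 + u₂ ^ 2 + u₃ ^ 2 + u₄ ^ 2) - (v₁ ^ 2 + v₂ ^ 2)) / 2) := by
  have id := K0_add_wall_mul₁ u₁ u₂ u₃ u₄ v₁ v₂ hC
  rw [hP4, mul_zero] at id
  by_contra h
  push Not at h
  have : (u₁ ^ 2 - ((u₁ ^ 2 + u₂ ^ 2 + u₃ ^ 2 + u₄ ^ 2) - (v₁ ^ 2 + v₂ ^ 2)) / 2) * ((u₁ - v₁) * (u₁ - v₂)) ≤ 0 := mul_nonpos_of_nonpos_of_nonneg h hβ.le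
  linarith

/-- Wall sign from the wall identity, root `E₁`: `β > 0 ∧ K > 0 ⇒ w < 0`. -/
theorem wall₁_neg_of_K_pos (u₁ u₂ u₃ u₄ v₁ v₂ : ℝ) (hC : u₁ + u₂ + u₃ + u₄ = v₁ + v₂)
    (hP4 : (u₁ ^ 3 + u₂ ^ 3 + u₃ ^ 3 + u₄ ^ 3) - (v₁ ^ 3 + v₂ ^ 3) = 0)
    (hK : 0 < (u₁ - v₁) * (u₂ - v₁) * (u₃ - v₁) * (u₄ - v₁)) (hβ : 0 < (u₁ - v₁) * (u₁ - v₂)) :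
    (u₁ ^ 2 - ((u₁ ^ 2 + u₂ ^ 2 + u₃ ^ 2 + u₄ ^ 2) - (v₁ ^ 2 + v₂ ^ 2)) / 2) < 0 := by
  have id := K0_add_wall_mul₁ u₁ u₂ u₃ u₄ v₁ v₂ hC
  rw [hP4, mul_zero] at id
  by_contra h
  push Not at h
  have : 0 ≤ (u₁ ^ 2 - ((u₁ ^ 2 + u₂ ^ 2 + u₃ ^ 2 + u₄ ^ 2) - (v₁ ^ 2 + v₂ ^ 2)) / 2) * ((u₁ - v₁) * (u₁ - v₂)) := mul_nonneg h hβ.le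
  linarith

/-- Wall sign from the wall identity, root `E₂`: on the pure locus `w·β = −K`; `β > 0 ∧ K < 0 ⇒ w > 0`. -/
theorem wall₂_pos_of_K_neg (u₁ u₂ u₃ u₄ v₁ v₂ : ℝ) (hC : u₁ + u₂ + u₃ + u₄ = v₁ + v₂)
    (hP4 : (u₁ ^ 3 + u₂ ^ 3 + u₃ ^ 3 + u₄ ^ 3) - (v₁ ^ 3 + v₂ ^ 3) = 0)
    (hK : (u₁ - v₁) * (u₂ - v₁) * (u₃ - v₁) * (u₄ - v₁) < 0) (hβ : 0 < (u₂ - v₁) * (u₂ - v₂)) :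
    0 < (u₂ ^ 2 - ((u₁ ^ 2 + u₂ ^ 2 + u₃ ^ 2 + u₄ ^ 2) - (v₁ ^ 2 + v₂ ^ 2)) / 2) := by
  have id := K0_add_wall_mul₂ u₁ u₂ u₃ u₄ v₁ v₂ hC
  rw [hP4, mul_zero] at id
  by_contra h
  push Not at h
  have : (u₂ ^ 2 - ((u₁ ^ 2 + u₂ ^ 2 + u₃ ^ 2 + u₄ ^ 2) - (v₁ ^ 2 + v₂ ^ 2)) / 2) * ((u₂ - v₁) * (u₂ - v₂)) ≤ 0 := mul_nonpos_of_nonpos_of_nonneg h hβ.le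
  linarith

/-- Wall sign from the wall identity, root `E₂`: `β > 0 ∧ K > 0 ⇒ w < 0`. -/
theorem wall₂_neg_of_K_pos (u₁ u₂ u₃ u₄ v₁ v₂ : ℝ) (hC : u₁ + u₂ + u₃ + u₄ = v₁ + v₂)
    (hP4 : (u₁ ^ 3 + u₂ ^ 3 + u₃ ^ 3 + u₄ ^ 3) - (v₁ ^ 3 + v₂ ^ 3) = 0)
    (hK : 0 < (u₁ - v₁) * (u₂ - v₁) * (u₃ - v₁) * (u₄ - v₁)) (hβ : 0 < (u₂ - v₁) * (u₂ - v₂)) :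
    (u₂ ^ 2 - ((u₁ ^ 2 + u₂ ^ 2 + u₃ ^ 2 + u₄ ^ 2) - (v₁ ^ 2 + v₂ ^ 2)) / 2) < 0 := by
  have id := K0_add_wall_mul₂ u₁ u₂ u₃ u₄ v₁ v₂ hC
  rw [hP4, mul_zero] at id
  by_contra h
  push Not at h
  have : 0 ≤ (u₂ ^ 2 - ((u₁ ^ 2 + u₂ ^ 2 + u₃ ^ 2 + u₄ ^ 2) - (v₁ ^ 2 + v₂ ^ 2)) / 2) * ((u₂ - v₁) * (u₂ - v₂)) := mul_nonneg h hβ.le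
  linarith

/-- Wall sign from the wall identity, root `E₃`: on the pure locus `w·β = −K`; `β > 0 ∧ K < 0 ⇒ w > 0`. -/
theorem wall₃_pos_of_K_neg (u₁ u₂ u₃ u₄ v₁ v₂ : ℝ) (hC : u₁ + u₂ + u₃ + u₄ = v₁ + v₂)
    (hP4 : (u₁ ^ 3 + u₂ ^ 3 + u₃ ^ 3 + u₄ ^ 3) - (v₁ ^ 3 + v₂ ^ 3) = 0)
    (hK : (u₁ - v₁) * (u₂ - v₁) * (u₃ - v₁) * (u₄ - v₁) < 0) (hβ : 0 < (u₃ - v₁) * (u₃ - v₂)) :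
    0 < (u₃ ^ 2 - ((u₁ ^ 2 + u₂ ^ 2 + u₃ ^ 2 + u₄ ^ 2) - (v₁ ^ 2 + v₂ ^ 2)) / 2) := by
  have id := K0_add_wall_mul₃ u₁ u₂ u₃ u₄ v₁ v₂ hC
  rw [hP4, mul_zero] at id
  by_contra h
  push Not at h
  have : (u₃ ^ 2 - ((u₁ ^ 2 + u₂ ^ 2 + u₃ ^ 2 + u₄ ^ 2) - (v₁ ^ 2 + v₂ ^ 2)) / 2) * ((u₃ - v₁) * (u₃ - v₂)) ≤ 0 := mul_nonpos_of_nonpos_of_nonneg h hβ.le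
  linarith

/-- Wall sign from the wall identity, root `E₃`: `β > 0 ∧ K > 0 ⇒ w < 0`. -/
theorem wall₃_neg_of_K_pos (u₁ u₂ u₃ u₄ v₁ v₂ : ℝ) (hC : u₁ + u₂ + u₃ + u₄ = v₁ + v₂)
    (hP4 : (u₁ ^ 3 + u₂ ^ 3 + u₃ ^ 3 + u₄ ^ 3) - (v₁ ^ 3 + v₂ ^ 3) = 0)
    (hK : 0 < (u₁ - v₁) * (u₂ - v₁) * (u₃ - v₁) * (u₄ - v₁)) (hβ : 0 < (u₃ - v₁) * (u₃ - v₂)) :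
    (u₃ ^ 2 - ((u₁ ^ 2 + u₂ ^ 2 + u₃ ^ 2 + u₄ ^ 2) - (v₁ ^ 2 + v₂ ^ 2)) / 2) < 0 := by
  have id := K0_add_wall_mul₃ u₁ u₂ u₃ u₄ v₁ v₂ hC
  rw [hP4, mul_zero] at id
  by_contra h
  push Not at h
  have : 0 ≤ (u₃ ^ 2 - ((u₁ ^ 2 + u₂ ^ 2 + u₃ ^ 2 + u₄ ^ 2) - (v₁ ^ 2 + v₂ ^ 2)) / 2) * ((u₃ - v₁) * (u₃ - v₂)) := mul_nonneg h hβ.le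
  linarith

/-- Wall sign from the wall identity, root `E₄`: on the pure locus `w·β = −K`; `β > 0 ∧ K < 0 ⇒ w > 0`. -/
theorem wall₄_pos_of_K_neg (u₁ u₂ u₃ u₄ v₁ v₂ : ℝ) (hC : u₁ + u₂ + u₃ + u₄ = v₁ + v₂)
    (hP4 : (u₁ ^ 3 + u₂ ^ 3 + u₃ ^ 3 + u₄ ^ 3) - (v₁ ^ 3 + v₂ ^ 3) = 0)
    (hK : (u₁ - v₁) * (u₂ - v₁) * (u₃ - v₁) * (u₄ - v₁) < 0) (hβ : 0 < (u₄ - v₁) * (u₄ - v₂)) :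
    0 < (u₄ ^ 2 - ((u₁ ^ 2 + u₂ ^ 2 + u₃ ^ 2 + u₄ ^ 2) - (v₁ ^ 2 + v₂ ^ 2)) / 2) := by
  have id := K0_add_wall_mul₄ u₁ u₂ u₃ u₄ v₁ v₂ hC
  rw [hP4, mul_zero] at id
  by_contra h
  push Not at h
  have : (u₄ ^ 2 - ((u₁ ^ 2 + u₂ ^ 2 + u₃ ^ 2 + u₄ ^ 2) - (v₁ ^ 2 + v₂ ^ 2)) / 2) * ((u₄ - v₁) * (u₄ - v₂)) ≤ 0 := mul_nonpos_of_nonpos_of_nonneg h hβ.le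
  linarith

/-- Wall sign from the wall identity, root `E₄`: `β > 0 ∧ K > 0 ⇒ w < 0`. -/
theorem wall₄_neg_of_K_pos (u₁ u₂ u₃ u₄ v₁ v₂ : ℝ) (hC : u₁ + u₂ + u₃ + u₄ = v₁ + v₂)
    (hP4 : (u₁ ^ 3 + u₂ ^ 3 + u₃ ^ 3 + u₄ ^ 3) - (v₁ ^ 3 + v₂ ^ 3) = 0)
    (hK : 0 < (u₁ - v₁) * (u₂ - v₁) * (u₃ - v₁) * (u₄ - v₁)) (hβ : 0 < (u₄ - v₁) * (u₄ - v₂)) :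
    (u₄ ^ 2 - ((u₁ ^ 2 + u₂ ^ 2 + u₃ ^ 2 + u₄ ^ 2) - (v₁ ^ 2 + v₂ ^ 2)) / 2) < 0 := by
  have id := K0_add_wall_mul₄ u₁ u₂ u₃ u₄ v₁ v₂ hC
  rw [hP4, mul_zero] at id
  by_contra h
  push Not at h
  have : 0 ≤ (u₄ ^ 2 - ((u₁ ^ 2 + u₂ ^ 2 + u₃ ^ 2 + u₄ ^ 2) - (v₁ ^ 2 + v₂ ^ 2)) / 2) * ((u₄ - v₁) * (u₄ - v₂)) := mul_nonneg h hβ.le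
  linarith

/-- Convexity of the wall function `t ↦ t² − S/2`: a charge between two charges with negative walls has a negative wall. -/
theorem wall_neg_between (t p q S : ℝ) (hp : p ≤ t) (hq : t ≤ q) (wp : p ^ 2 - S / 2 < 0) (wq : q ^ 2 - S / 2 < 0) :
    t ^ 2 - S / 2 < 0 := by
  rcases le_or_gt 0 t with ht | ht
  · have : t ^ 2 ≤ q ^ 2 := by nlinarith
    linarith
  · have : t ^ 2 ≤ p ^ 2 := by nlinarith
    linarith

/-- From a sum of six non-negative terms equal to zero, the first term vanishes (bookkeeping helper). -/
theorem first_eq_zero_of_sum_six (t₁ t₂ t₃ t₄ t₅ t₆ : ℝ) (h₁ : 0 ≤ t₁) (h₂ : 0 ≤ t₂) (h₃ : 0 ≤ t₃) (h₄ : 0 ≤ t₄) (h₅ : 0 ≤ t₅) (h₆ : 0 ≤ t₆)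
    (hs : t₁ + t₂ + t₃ + t₄ + (t₅ + t₆) = 0) : t₁ = 0 := by
  linarith

/-- EXCLUSION OF THE PATTERNS WITH NO E-CHARGE BETWEEN THE F-CHARGES when `K < 0` (patterns `E F F E E E`, `E E E F F E`):
if every `β_e = (u_e − v₁)(u_e − v₂)` is `> 0` then all four E-walls are positive (wall identity), hence both F-walls
(`WeilClassTestSignLaw.F_walls_pos_of_E_walls_pos` for `σ ≠ 0`; for `σ = 0` directly), and the gauge form of P2 (`Σ heights·walls = 0`)
forces all heights to vanish, contradicting `β₁ > 0` via ampleness. -/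
theorem no_config_K_neg_none_between (A₁ A₂ A₃ A₄ B₁ B₂ u₁ u₂ u₃ u₄ v₁ v₂ : ℝ)
    (hA : A₁ + A₂ + A₃ + A₄ = B₁ + B₂) (hC : u₁ + u₂ + u₃ + u₄ = v₁ + v₂)
    (hP2 : (A₁ * u₁ ^ 2 + A₂ * u₂ ^ 2 + A₃ * u₃ ^ 2 + A₄ * u₄ ^ 2) - (B₁ * v₁ ^ 2 + B₂ * v₂ ^ 2) = 0)
    (hP4 : (u₁ ^ 3 + u₂ ^ 3 + u₃ ^ 3 + u₄ ^ 3) - (v₁ ^ 3 + v₂ ^ 3) = 0)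
    (m₁₁ : |u₁ - v₁| ≤ A₁ - B₁) (m₂₁ : |u₂ - v₁| ≤ A₂ - B₁) (m₃₁ : |u₃ - v₁| ≤ A₃ - B₁) (m₄₁ : |u₄ - v₁| ≤ A₄ - B₁)
    (m₁₂ : |u₁ - v₂| ≤ A₁ - B₂) (m₂₂ : |u₂ - v₂| ≤ A₂ - B₂) (m₃₂ : |u₃ - v₂| ≤ A₃ - B₂) (m₄₂ : |u₄ - v₂| ≤ A₄ - B₂)
    (hK : (u₁ - v₁) * (u₂ - v₁) * (u₃ - v₁) * (u₄ - v₁) < 0)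
    (hβ₁ : 0 < (u₁ - v₁) * (u₁ - v₂)) (hβ₂ : 0 < (u₂ - v₁) * (u₂ - v₂)) (hβ₃ : 0 < (u₃ - v₁) * (u₃ - v₂)) (hβ₄ : 0 < (u₄ - v₁) * (u₄ - v₂)) :
    False := by
  have w1 := wall₁_pos_of_K_neg u₁ u₂ u₃ u₄ v₁ v₂ hC hP4 hK hβ₁
  have w2 := wall₂_pos_of_K_neg u₁ u₂ u₃ u₄ v₁ v₂ hC hP4 hK hβ₂
  have w3 := wall₃_pos_of_K_neg u₁ u₂ u₃ u₄ v₁ v₂ hC hP4 hK hβ₃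
  have w4 := wall₄_pos_of_K_neg u₁ u₂ u₃ u₄ v₁ v₂ hC hP4 hK hβ₄
  -- both F-walls are positive
  have wF : 0 < (v₁ ^ 2 - ((u₁ ^ 2 + u₂ ^ 2 + u₃ ^ 2 + u₄ ^ 2) - (v₁ ^ 2 + v₂ ^ 2)) / 2) ∧ 0 < (v₂ ^ 2 - ((u₁ ^ 2 + u₂ ^ 2 + u₃ ^ 2 + u₄ ^ 2) - (v₁ ^ 2 + v₂ ^ 2)) / 2) := by
    by_cases hσ : u₁ + u₂ + u₃ + u₄ = 0
    · -- σ = 0: v₂ = −v₁; four positive E-walls give Σu² < 4v₁², so some u_e² < v₁² = v₁v₂-reflected, i.e. β_e < 0: contradiction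
      exfalso
      have hv : v₂ = -v₁ := by linarith
      have ev : v₂ ^ 2 = v₁ ^ 2 := by rw [hv]; ring
      have e1 : (u₁ - v₁) * (u₁ - v₂) = u₁ ^ 2 - v₁ ^ 2 := by rw [hv]; ring
      have e2 : (u₂ - v₁) * (u₂ - v₂) = u₂ ^ 2 - v₁ ^ 2 := by rw [hv]; ring
      have e3 : (u₃ - v₁) * (u₃ - v₂) = u₃ ^ 2 - v₁ ^ 2 := by rw [hv]; ring
      have e4 : (u₄ - v₁) * (u₄ - v₂) = u₄ ^ 2 - v₁ ^ 2 := by rw [hv]; ring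
      linarith
    · have h3 : u₁ ^ 3 + u₂ ^ 3 + u₃ ^ 3 + u₄ ^ 3 = v₁ ^ 3 + v₂ ^ 3 := by linarith
      have hF := Summit.HodgeConjecture.HodgeConjecture.WeilClassTestSignLaw.F_walls_pos_of_E_walls_pos u₁ u₂ u₃ u₄ v₁ v₂
        (u₁ ^ 2 + u₂ ^ 2 + u₃ ^ 2 + u₄ ^ 2 - v₁ ^ 2 - v₂ ^ 2) rfl hσ hC h3 (by linarith) (by linarith) (by linarith) (by linarith)
      constructor
      · linarith [hF.1]
      · linarith [hF.2]
  obtain ⟨w5, w6⟩ := wF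
  have ha₁ : 0 ≤ A₁ - B₁ := le_trans (abs_nonneg _) m₁₁
  have ha₂ : 0 ≤ A₂ - B₁ := le_trans (abs_nonneg _) m₂₁
  have ha₃ : 0 ≤ A₃ - B₁ := le_trans (abs_nonneg _) m₃₁
  have ha₄ : 0 ≤ A₄ - B₁ := le_trans (abs_nonneg _) m₄₁
  have ha₁' : 0 ≤ A₁ - B₂ := le_trans (abs_nonneg _) m₁₂
  have ha₂' : 0 ≤ A₂ - B₂ := le_trans (abs_nonneg _) m₂₂
  have ha₃' : 0 ≤ A₃ - B₂ := le_trans (abs_nonneg _) m₃₂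
  have ha₄' : 0 ≤ A₄ - B₂ := le_trans (abs_nonneg _) m₄₂
  rcases le_total B₁ B₂ with hB | hB
  · -- level at B₂
    have hg := P2_gauge A₁ A₂ A₃ A₄ B₁ B₂ u₁ u₂ u₃ u₄ v₁ v₂ B₂ hA
    rw [hP2] at hg
    have t1 : (A₁ - B₂) * (u₁ ^ 2 - ((u₁ ^ 2 + u₂ ^ 2 + u₃ ^ 2 + u₄ ^ 2) - (v₁ ^ 2 + v₂ ^ 2)) / 2) = 0 :=
      first_eq_zero_of_sum_six _ _ _ _ _ _ (mul_nonneg ha₁' w1.le) (mul_nonneg ha₂' w2.le) (mul_nonneg ha₃' w3.le)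
        (mul_nonneg ha₄' w4.le) (mul_nonneg (by linarith) w5.le) (mul_nonneg (by linarith) w6.le) hg.symm
    have hA1 : A₁ - B₂ = 0 := by
      rcases mul_eq_zero.mp t1 with h | h
      · exact h
      · exact absurd h (ne_of_gt w1)
    have : |u₁ - v₂| ≤ 0 := by linarith
    have hu : u₁ - v₂ = 0 := abs_nonpos_iff.mp this
    have : (u₁ - v₁) * (u₁ - v₂) = 0 := by rw [hu, mul_zero]
    linarith
  · -- level at B₁
    have hg := P2_gauge A₁ A₂ A₃ A₄ B₁ B₂ u₁ u₂ u₃ u₄ v₁ v₂ B₁ hA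
    rw [hP2] at hg
    have t1 : (A₁ - B₁) * (u₁ ^ 2 - ((u₁ ^ 2 + u₂ ^ 2 + u₃ ^ 2 + u₄ ^ 2) - (v₁ ^ 2 + v₂ ^ 2)) / 2) = 0 :=
      first_eq_zero_of_sum_six _ _ _ _ _ _ (mul_nonneg ha₁ w1.le) (mul_nonneg ha₂ w2.le) (mul_nonneg ha₃ w3.le)
        (mul_nonneg ha₄ w4.le) (mul_nonneg (by linarith) w5.le) (mul_nonneg (by linarith) w6.le) hg.symm
    have hA1 : A₁ - B₁ = 0 := by
      rcases mul_eq_zero.mp t1 with h | h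
      · exact h
      · exact absurd h (ne_of_gt w1)
    have : |u₁ - v₁| ≤ 0 := by linarith
    have hu : u₁ - v₁ = 0 := abs_nonpos_iff.mp this
    have : (u₁ - v₁) * (u₁ - v₂) = 0 := by rw [hu, zero_mul]
    linarith

/-- EXCLUSION OF `K > 0` WHEN ONE E-CHARGE IS BELOW BOTH F-CHARGES AND ANOTHER ABOVE BOTH (`u₁ < v₁ ≤ v₂ < u₄`, `u₁ ≤ u₂, u₃ ≤ u₄`):
`w₁, w₄ < 0` by the wall identity, every other charge lies between `u₁` and `u₄` so its wall is `< 0` too (convexity), and the gauge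
form of P2 forces all heights to vanish — contradicting `u₁ < v₂` via ampleness. -/
theorem no_config_K_pos_split (A₁ A₂ A₃ A₄ B₁ B₂ u₁ u₂ u₃ u₄ v₁ v₂ : ℝ)
    (hA : A₁ + A₂ + A₃ + A₄ = B₁ + B₂) (hC : u₁ + u₂ + u₃ + u₄ = v₁ + v₂)
    (hP2 : (A₁ * u₁ ^ 2 + A₂ * u₂ ^ 2 + A₃ * u₃ ^ 2 + A₄ * u₄ ^ 2) - (B₁ * v₁ ^ 2 + B₂ * v₂ ^ 2) = 0)
    (hP4 : (u₁ ^ 3 + u₂ ^ 3 + u₃ ^ 3 + u₄ ^ 3) - (v₁ ^ 3 + v₂ ^ 3) = 0)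
    (m₁₁ : |u₁ - v₁| ≤ A₁ - B₁) (m₂₁ : |u₂ - v₁| ≤ A₂ - B₁) (m₃₁ : |u₃ - v₁| ≤ A₃ - B₁) (m₄₁ : |u₄ - v₁| ≤ A₄ - B₁)
    (m₁₂ : |u₁ - v₂| ≤ A₁ - B₂) (m₂₂ : |u₂ - v₂| ≤ A₂ - B₂) (m₃₂ : |u₃ - v₂| ≤ A₃ - B₂) (m₄₂ : |u₄ - v₂| ≤ A₄ - B₂)
    (o₂ : u₁ ≤ u₂) (o₂' : u₂ ≤ u₄) (o₃ : u₁ ≤ u₃) (o₃' : u₃ ≤ u₄) (hv : v₁ ≤ v₂)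
    (c₁ : u₁ < v₁) (c₄ : v₂ < u₄)
    (hK : 0 < (u₁ - v₁) * (u₂ - v₁) * (u₃ - v₁) * (u₄ - v₁)) :
    False := by
  have hβ₁ : 0 < (u₁ - v₁) * (u₁ - v₂) := mul_pos_of_neg_of_neg (by linarith) (by linarith)
  have hβ₄ : 0 < (u₄ - v₁) * (u₄ - v₂) := mul_pos (by linarith) (by linarith)
  have w1 := wall₁_neg_of_K_pos u₁ u₂ u₃ u₄ v₁ v₂ hC hP4 hK hβ₁
  have w4 := wall₄_neg_of_K_pos u₁ u₂ u₃ u₄ v₁ v₂ hC hP4 hK hβ₄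
  have w2 := wall_neg_between u₂ u₁ u₄ ((u₁ ^ 2 + u₂ ^ 2 + u₃ ^ 2 + u₄ ^ 2) - (v₁ ^ 2 + v₂ ^ 2)) o₂ o₂' w1 w4
  have w3 := wall_neg_between u₃ u₁ u₄ ((u₁ ^ 2 + u₂ ^ 2 + u₃ ^ 2 + u₄ ^ 2) - (v₁ ^ 2 + v₂ ^ 2)) o₃ o₃' w1 w4
  have w5 := wall_neg_between v₁ u₁ u₄ ((u₁ ^ 2 + u₂ ^ 2 + u₃ ^ 2 + u₄ ^ 2) - (v₁ ^ 2 + v₂ ^ 2)) (by linarith) (by linarith) w1 w4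
  have w6 := wall_neg_between v₂ u₁ u₄ ((u₁ ^ 2 + u₂ ^ 2 + u₃ ^ 2 + u₄ ^ 2) - (v₁ ^ 2 + v₂ ^ 2)) (by linarith) (by linarith) w1 w4
  have ha₁ : 0 ≤ A₁ - B₁ := le_trans (abs_nonneg _) m₁₁
  have ha₂ : 0 ≤ A₂ - B₁ := le_trans (abs_nonneg _) m₂₁
  have ha₃ : 0 ≤ A₃ - B₁ := le_trans (abs_nonneg _) m₃₁
  have ha₄ : 0 ≤ A₄ - B₁ := le_trans (abs_nonneg _) m₄₁
  have ha₁' : 0 ≤ A₁ - B₂ := le_trans (abs_nonneg _) m₁₂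
  have ha₂' : 0 ≤ A₂ - B₂ := le_trans (abs_nonneg _) m₂₂
  have ha₃' : 0 ≤ A₃ - B₂ := le_trans (abs_nonneg _) m₃₂
  have ha₄' : 0 ≤ A₄ - B₂ := le_trans (abs_nonneg _) m₄₂
  rcases le_total B₁ B₂ with hB | hB
  · have hg := P2_gauge A₁ A₂ A₃ A₄ B₁ B₂ u₁ u₂ u₃ u₄ v₁ v₂ B₂ hA
    rw [hP2] at hg
    have t1 : (A₁ - B₂) * (-(u₁ ^ 2 - ((u₁ ^ 2 + u₂ ^ 2 + u₃ ^ 2 + u₄ ^ 2) - (v₁ ^ 2 + v₂ ^ 2)) / 2)) = 0 :=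
      first_eq_zero_of_sum_six _ ((A₂ - B₂) * (-(u₂ ^ 2 - ((u₁ ^ 2 + u₂ ^ 2 + u₃ ^ 2 + u₄ ^ 2) - (v₁ ^ 2 + v₂ ^ 2)) / 2))) ((A₃ - B₂) * (-(u₃ ^ 2 - ((u₁ ^ 2 + u₂ ^ 2 + u₃ ^ 2 + u₄ ^ 2) - (v₁ ^ 2 + v₂ ^ 2)) / 2))) ((A₄ - B₂) * (-(u₄ ^ 2 - ((u₁ ^ 2 + u₂ ^ 2 + u₃ ^ 2 + u₄ ^ 2) - (v₁ ^ 2 + v₂ ^ 2)) / 2)))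
        ((B₂ - B₁) * (-(v₁ ^ 2 - ((u₁ ^ 2 + u₂ ^ 2 + u₃ ^ 2 + u₄ ^ 2) - (v₁ ^ 2 + v₂ ^ 2)) / 2))) ((B₂ - B₂) * (-(v₂ ^ 2 - ((u₁ ^ 2 + u₂ ^ 2 + u₃ ^ 2 + u₄ ^ 2) - (v₁ ^ 2 + v₂ ^ 2)) / 2)))
        (mul_nonneg ha₁' (by linarith)) (mul_nonneg ha₂' (by linarith)) (mul_nonneg ha₃' (by linarith))
        (mul_nonneg ha₄' (by linarith)) (mul_nonneg (by linarith) (by linarith)) (mul_nonneg (by linarith) (by linarith)) (by linarith)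
    have hA1 : A₁ - B₂ = 0 := by
      rcases mul_eq_zero.mp t1 with h | h
      · exact h
      · exfalso; linarith
    have : |u₁ - v₂| ≤ 0 := by linarith
    have hu : u₁ - v₂ = 0 := abs_nonpos_iff.mp this
    linarith
  · have hg := P2_gauge A₁ A₂ A₃ A₄ B₁ B₂ u₁ u₂ u₃ u₄ v₁ v₂ B₁ hA
    rw [hP2] at hg
    have t1 : (A₁ - B₁) * (-(u₁ ^ 2 - ((u₁ ^ 2 + u₂ ^ 2 + u₃ ^ 2 + u₄ ^ 2) - (v₁ ^ 2 + v₂ ^ 2)) / 2)) = 0 :=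
      first_eq_zero_of_sum_six _ ((A₂ - B₁) * (-(u₂ ^ 2 - ((u₁ ^ 2 + u₂ ^ 2 + u₃ ^ 2 + u₄ ^ 2) - (v₁ ^ 2 + v₂ ^ 2)) / 2))) ((A₃ - B₁) * (-(u₃ ^ 2 - ((u₁ ^ 2 + u₂ ^ 2 + u₃ ^ 2 + u₄ ^ 2) - (v₁ ^ 2 + v₂ ^ 2)) / 2))) ((A₄ - B₁) * (-(u₄ ^ 2 - ((u₁ ^ 2 + u₂ ^ 2 + u₃ ^ 2 + u₄ ^ 2) - (v₁ ^ 2 + v₂ ^ 2)) / 2)))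
        ((B₁ - B₁) * (-(v₁ ^ 2 - ((u₁ ^ 2 + u₂ ^ 2 + u₃ ^ 2 + u₄ ^ 2) - (v₁ ^ 2 + v₂ ^ 2)) / 2))) ((B₁ - B₂) * (-(v₂ ^ 2 - ((u₁ ^ 2 + u₂ ^ 2 + u₃ ^ 2 + u₄ ^ 2) - (v₁ ^ 2 + v₂ ^ 2)) / 2)))
        (mul_nonneg ha₁ (by linarith)) (mul_nonneg ha₂ (by linarith)) (mul_nonneg ha₃ (by linarith))
        (mul_nonneg ha₄ (by linarith)) (mul_nonneg (by linarith) (by linarith)) (mul_nonneg (by linarith) (by linarith)) (by linarith)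
    have hA1 : A₁ - B₁ = 0 := by
      rcases mul_eq_zero.mp t1 with h | h
      · exact h
      · exfalso; linarith
    have : |u₁ - v₁| ≤ 0 := by linarith
    have hu : u₁ - v₁ = 0 := abs_nonpos_iff.mp this
    linarith

end Summit.HodgeConjecture.HodgeConjecture.WeilClassTestFormatFourTwo
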